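import Summits.Ventures.CertifiedArithmetic.LowPrec.Exact
import Summits.Ventures.CertifiedArithmetic.LowPrec.Attain
import Summits.Ventures.CertifiedArithmetic.LowPrec.FormatsP3109

/-!
# Exact products of the P3109 / FNUZ 8-bit formats in bfloat16 and binary32

HONEST FRAMING (venture CertifiedArithmetic / cell `pub-lowprec`): certified error envelopes and
provably optimal rounding/accumulation schemes for low-precision formats under stated cost models;
every table by two implementations; no hardware or vendor claims.

Instances of `MiniFloat.exists_toRat_eq_mul` (Exact.lean: significand width `p_α ≥ p₁ + p₂`,
quantum alignment `d = q₁ + q₂ - q_α`, range) for the P3109/FNUZ operand pairs among the cell's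
104 gate-held keys (THEOREMS-R1 §5: binary8p3², binary8p4², binary8p5², binary8p3 Finite²,
binary8p4 Finite² (= FNUZ E5M2², FNUZ E4M3² as value sets), binary8p4·binary8p3) into the
accumulator formats `bfloat16` (`q = -133`, `p = 8`) and `binary32` (`q = -149`, `p = 24`): every
such product is exact EXCEPT `binary8p5 · binary8p5 → bfloat16` (`p₁ + p₂ = 10 > 8`), refuted by the
witness `31/16 · 31/16 = 961/256` (`961` odd, 10 significant bits). This is the Lean side of the
enum seat's pre-registered verdicts "all FP8 products into binary32 and bfloat16 exact except
binary8p5·binary8p5 → bfloat16".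
-/

namespace Literature.ComputerArithmetic.FloatingPoint

namespace Format

open MiniFloat

/-- `binary8p3 · binary8p3` is exact in `bfloat16` (`d = 99`). -/
theorem Binary8p3_mul_Binary8p3_exact_in_BFloat16 (x y : MiniFloat Binary8p3) :
    ∃ z : MiniFloat BFloat16, z.toRat = x.toRat * y.toRat :=
  exists_toRat_eq_mul (by decide) (d := 99) (by decide) (by decide +kernel) x y

/-- `binary8p3 · binary8p3` is exact in `binary32` (`d = 115`). -/
theorem Binary8p3_mul_Binary8p3_exact_in_Binary32 (x y : MiniFloat Binary8p3) :
    ∃ z : MiniFloat Binary32, z.toRat = x.toRat * y.toRat :=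
  exists_toRat_eq_mul (by decide) (d := 115) (by decide) (by decide +kernel) x y

/-- `binary8p4 · binary8p4` is exact in `bfloat16` (`d = 113`; `p₁ + p₂ = 8` is the limit case). -/
theorem Binary8p4_mul_Binary8p4_exact_in_BFloat16 (x y : MiniFloat Binary8p4) :
    ∃ z : MiniFloat BFloat16, z.toRat = x.toRat * y.toRat :=
  exists_toRat_eq_mul (by decide) (d := 113) (by decide) (by decide +kernel) x y

/-- `binary8p4 · binary8p4` is exact in `binary32` (`d = 129`). -/
theorem Binary8p4_mul_Binary8p4_exact_in_Binary32 (x y : MiniFloat Binary8p4) :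
    ∃ z : MiniFloat Binary32, z.toRat = x.toRat * y.toRat :=
  exists_toRat_eq_mul (by decide) (d := 129) (by decide) (by decide +kernel) x y

/-- `binary8p5 · binary8p5` is exact in `binary32` (`d = 135`). -/
theorem Binary8p5_mul_Binary8p5_exact_in_Binary32 (x y : MiniFloat Binary8p5) :
    ∃ z : MiniFloat Binary32, z.toRat = x.toRat * y.toRat :=
  exists_toRat_eq_mul (by decide) (d := 135) (by decide) (by decide +kernel) x y

/-- `binary8p3` Finite `· binary8p3` Finite (= FNUZ E5M2², value sets) is exact in `bfloat16`
(`d = 99`). -/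
theorem Binary8p3F_mul_Binary8p3F_exact_in_BFloat16 (x y : MiniFloat Binary8p3F) :
    ∃ z : MiniFloat BFloat16, z.toRat = x.toRat * y.toRat :=
  exists_toRat_eq_mul (by decide) (d := 99) (by decide) (by decide +kernel) x y

/-- `binary8p3` Finite squared is exact in `binary32` (`d = 115`). -/
theorem Binary8p3F_mul_Binary8p3F_exact_in_Binary32 (x y : MiniFloat Binary8p3F) :
    ∃ z : MiniFloat Binary32, z.toRat = x.toRat * y.toRat :=
  exists_toRat_eq_mul (by decide) (d := 115) (by decide) (by decide +kernel) x y

/-- `binary8p4` Finite `· binary8p4` Finite (= FNUZ E4M3², value sets) is exact in `bfloat16`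
(`d = 113`). -/
theorem Binary8p4F_mul_Binary8p4F_exact_in_BFloat16 (x y : MiniFloat Binary8p4F) :
    ∃ z : MiniFloat BFloat16, z.toRat = x.toRat * y.toRat :=
  exists_toRat_eq_mul (by decide) (d := 113) (by decide) (by decide +kernel) x y

/-- `binary8p4` Finite squared is exact in `binary32` (`d = 129`). -/
theorem Binary8p4F_mul_Binary8p4F_exact_in_Binary32 (x y : MiniFloat Binary8p4F) :
    ∃ z : MiniFloat Binary32, z.toRat = x.toRat * y.toRat :=
  exists_toRat_eq_mul (by decide) (d := 129) (by decide) (by decide +kernel) x y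

/-- `binary8p4 · binary8p3` is exact in `bfloat16` (`d = 106`). -/
theorem Binary8p4_mul_Binary8p3_exact_in_BFloat16 (x : MiniFloat Binary8p4) (y : MiniFloat Binary8p3) :
    ∃ z : MiniFloat BFloat16, z.toRat = x.toRat * y.toRat :=
  exists_toRat_eq_mul (by decide) (d := 106) (by decide) (by decide +kernel) x y

/-- `binary8p4 · binary8p3` is exact in `binary32` (`d = 122`). -/
theorem Binary8p4_mul_Binary8p3_exact_in_Binary32 (x : MiniFloat Binary8p4) (y : MiniFloat Binary8p3) :
    ∃ z : MiniFloat Binary32, z.toRat = x.toRat * y.toRat :=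
  exists_toRat_eq_mul (by decide) (d := 122) (by decide) (by decide +kernel) x y

/-- FNUZ E4M3² and FNUZ E5M2² are exact in `bfloat16` and `binary32` (same records as the P3109
Finite-domain formats). -/
theorem Fnuz_mul_exact (x y : MiniFloat FnuzE4M3) (x' y' : MiniFloat FnuzE5M2) :
    (∃ z : MiniFloat BFloat16, z.toRat = x.toRat * y.toRat) ∧
    (∃ z : MiniFloat Binary32, z.toRat = x.toRat * y.toRat) ∧
    (∃ z : MiniFloat BFloat16, z.toRat = x'.toRat * y'.toRat) ∧
    (∃ z : MiniFloat Binary32, z.toRat = x'.toRat * y'.toRat) :=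
  ⟨Binary8p4F_mul_Binary8p4F_exact_in_BFloat16 x y, Binary8p4F_mul_Binary8p4F_exact_in_Binary32 x y,
   Binary8p3F_mul_Binary8p3F_exact_in_BFloat16 x' y', Binary8p3F_mul_Binary8p3F_exact_in_Binary32 x' y'⟩

/-- NON-INSTANCE (precision witness): `binary8p5 · binary8p5` is NOT always a `bfloat16` value —
`31/16 · 31/16 = 961/256` has the odd 10-bit significand `961 = 31²`, but a `bfloat16` value is
`k · 2^j · 2^-133` with `k < 2^8`. -/
theorem Binary8p5_mul_Binary8p5_not_exact_in_BFloat16 :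
    ¬ ∀ x y : MiniFloat Binary8p5, ∃ z : MiniFloat BFloat16, z.toRat = x.toRat * y.toRat := by
  intro h
  let w : MiniFloat Binary8p5 := ⟨false, 4, 15, by decide, by decide, by decide⟩
  obtain ⟨z, hz⟩ := h w w
  have hw : w.toRat = 31 / 16 := by decide +kernel
  rw [hw] at hz
  -- the scaled magnitude of `z` is `k · 2^j` with `k < 2^8`
  obtain ⟨-, k, j, hk, hn⟩ := representable_iff.mp (representable_scaledMag z)
  have habs : |z.toRat| = (z.scaledMag : ℚ) * BFloat16.quantum := abs_toRat z
  rw [hz, hn, BFloat16_maxRat.2, abs_of_pos (by norm_num)] at habs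
  push_cast at habs
  -- `k · 2^j = 961 · 2^125`, so the odd number `961` divides `k`
  have e : (k : ℚ) * 2 ^ j = 961 * 2 ^ 125 := by
    have h' : (k : ℚ) * 2 ^ j = 31 / 16 * (31 / 16) * 2 ^ 133 := by
      rw [habs]; field_simp
    rw [h']; norm_num
  have hkj : (k : ℚ) * (2 : ℚ) ^ (j : ℤ) = ((961 : ℕ) : ℚ) * (2 : ℚ) ^ ((125 : ℕ) : ℤ) := by
    rw [zpow_natCast, zpow_natCast, e]; push_cast; rfl
  have hdvd : 961 ∣ k := MiniFloat.dvd_of_mul_zpow_eq (by decide) hkj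
  -- hence `k = 0` (as `k < 256 < 961`), i.e. `z = 0`, contradicting `z.toRat = 961/256`
  have hk' : k < 256 := by simpa [BFloat16] using hk
  have hk0 : k = 0 := by
    rcases hdvd with ⟨c, hc⟩
    rcases Nat.eq_zero_or_pos c with h0 | hpos
    · rw [hc, h0, mul_zero]
    · exfalso
      have : 961 ≤ k := by rw [hc]; exact Nat.le_mul_of_pos_right _ hpos
      omega
  rw [hk0] at e
  norm_num at e

end Format

end Literature.ComputerArithmetic.FloatingPoint
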